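import Literature.NumberTheory.GaloisRepresentations.SerreCartanNormalizerGL2Fp
import Literature.NumberTheory.GaloisRepresentations.DeligneSerreGL2SubgroupsProofs
import Literature.NumberTheory.EllipticCurves.GaloisAction
import HarnessLib

/-!
# Route `SignedLowerHalves`, crux L `SmallImageLowerHalfBothSigns` (stmt-BirchSwinnertonDyer-23599), line `rtt_w3` v12 — glue brick I-k (the `k`-STRUCTURE
# ENDOMORPHISM for the cores-pair injectivity): from the small-image datum `(Φ, k, e₀)` of the registered stub (`ρ̄(Γ_ℚ)` normalises the non-split Cartan
# subgroup `kˣ`, `k ⊆ M₂(𝔽_p)` a field of degree `2`, `p` odd) an additive endomorphism `u` of `W[p]` with a two-sided inverse `v`, commuting with every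
# `σ` with `ρ̄(σ) ∈ kˣ` and ANTI-commuting with every `c` with `ρ̄(c) ∉ kˣ`: `u(c • m) = −c • u(m)` — exactly the hypotheses `u v hu hv hcu hvu` of the
# landed cores lemma `…RttCharRoadE1CoresDescent.injective_corH1_prod_corH1_pushH1` (p765568) for `M = W[p]`, `N = Γ_{K_n}` (`ρ̄(Γ_K) ⊆ kˣ`).

LEAD `cruxlead-stmt-BirchSwinnertonDyer-23599` g7 (cell `bsd-ssimc`; `--supports stmt-BirchSwinnertonDyer-23599 --as helper`). THEOREMS ONLY (no definition,
no named fact, no instance, no `sorry`); pure linear algebra over `𝔽_p` (Serre 1972 §2.2: an element of the normaliser `N` of a non-split Cartan `C = kˣ`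
outside `C` acts on `k` by the Frobenius, `y ↦ ȳ = tr(y) − y`; on a TRACE-ZERO generator `y = √d` this is `y ↦ −y`). BSD / crux L / INJ_top are NOT proved here.

WHAT: `exists_mem_traceZero_forall_ne_smul_one` (a trace-zero non-scalar `y ∈ k`, `p` odd), `conj_eq_neg_of_not_mem_unitGroup` (`g y g⁻¹ = −y` for `g ∈ N ∖ C`),
★ `exists_kStructure_endomorphism` (the pair `u, v` on `W[p] = geomTorsion W p`, transported through `e₀`).

References: [Serre1972] §2.1 b), §2.2; [SerreGaloisCohomology1997] I §2.6 (b) (corestriction for an index-two subgroup — where `u` is consumed).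
-/

set_option autoImplicit false
set_option linter.dupNamespace false -- D-0017: single-problem summit, the namespace repeats the problem name by design
noncomputable section

open scoped Classical MatrixGroups
open Matrix

namespace Summit.BirchSwinnertonDyer.BirchSwinnertonDyer.Theorems.SmallImageCharSignedSelmer

open Literature.NumberTheory.GaloisRepresentations Literature.NumberTheory.GaloisRepresentations.Serre1972
  Literature.NumberTheory.EllipticCurves WeierstrassCurve

/-! ## §1 Linear algebra in a quadratic field `k ⊆ M₂(𝔽_p)`, `p` odd -/

section Field

variable {p : ℕ} [Fact p.Prime]

/-- **A trace-zero non-scalar element of `k`** (`k ⊆ M₂(𝔽_p)` of dimension `2`, `p` odd): `y = 2y₁ − tr(y₁)·1` for any non-scalar `y₁ ∈ k`.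
[cite: Serre1972, §2.1 b)] -/
theorem exists_mem_traceZero_forall_ne_smul_one (hp : p ≠ 2) {k : Subalgebra (ZMod p) (Matrix (Fin 2) (Fin 2) (ZMod p))}
    (h2 : Module.finrank (ZMod p) k = 2) :
    ∃ y ∈ k, (∀ c : ZMod p, y ≠ c • 1) ∧ y.trace = 0 := by
  obtain ⟨y₁, hy₁, hys₁⟩ := exists_mem_forall_ne_smul_one h2
  have h2ne : (2 : ZMod p) ≠ 0 := DeligneSerre1974.two_ne_zero_of_ne_two hp
  refine ⟨(2 : ZMod p) • y₁ - y₁.trace • (1 : Matrix (Fin 2) (Fin 2) (ZMod p)),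
    k.sub_mem (k.smul_mem hy₁ _) (k.smul_mem k.one_mem _), fun c hc ↦ ?_, ?_⟩
  · apply hys₁ ((2 : ZMod p)⁻¹ * (c + y₁.trace))
    have h : (2 : ZMod p) • y₁ = (c + y₁.trace) • (1 : Matrix (Fin 2) (Fin 2) (ZMod p)) := by
      rw [add_smul, ← hc, sub_add_cancel]
    calc y₁ = (2 : ZMod p)⁻¹ • ((2 : ZMod p) • y₁) := by rw [smul_smul, inv_mul_cancel₀ h2ne, one_smul]
      _ = ((2 : ZMod p)⁻¹ * (c + y₁.trace)) • 1 := by rw [h, smul_smul]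
  · rw [Matrix.trace_sub, Matrix.trace_smul, Matrix.trace_smul, Matrix.trace_one, Fintype.card_fin, smul_eq_mul, smul_eq_mul]
    push_cast
    ring

/-- **An element of the normaliser of `kˣ` outside `kˣ` negates a trace-zero non-scalar `y ∈ k`**: `g y g⁻¹` is `y` or `ȳ = tr(y)·1 − y`
(`conj_eq_or_conj_eq_of_mem_normalizer`); the first case forces `g ∈ kˣ` (`mem_unitGroup_of_conj_eq`). [cite: Serre1972, §2.2] -/
theorem conj_eq_neg_of_not_mem_unitGroup {k : Subalgebra (ZMod p) (Matrix (Fin 2) (Fin 2) (ZMod p))} (hk : IsField k)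
    {y : Matrix (Fin 2) (Fin 2) (ZMod p)} (hy : y ∈ k) (hys : ∀ c : ZMod p, y ≠ c • 1) (htr : y.trace = 0)
    {g : GL (Fin 2) (ZMod p)} (hgN : g ∈ Subgroup.normalizer (unitGroup k : Set (GL (Fin 2) (ZMod p)))) (hgC : g ∉ unitGroup k) :
    (g : Matrix (Fin 2) (Fin 2) (ZMod p)) * y = -(y * (g : Matrix (Fin 2) (Fin 2) (ZMod p))) := by
  have hgu : IsUnit (g : Matrix (Fin 2) (Fin 2) (ZMod p)).det := (GL2.det_ne_zero g).isUnit
  rcases conj_eq_or_conj_eq_of_mem_normalizer hk hy hys hgN with h | h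
  · exact absurd (mem_unitGroup_of_conj_eq hy hys h) hgC
  · rw [htr, zero_smul, zero_sub] at h
    calc (g : Matrix (Fin 2) (Fin 2) (ZMod p)) * y
        = (g : Matrix (Fin 2) (Fin 2) (ZMod p)) * y * (g : Matrix (Fin 2) (Fin 2) (ZMod p))⁻¹ * g :=
          (Matrix.nonsing_inv_mul_cancel_right _ _ hgu).symm
      _ = -(y * (g : Matrix (Fin 2) (Fin 2) (ZMod p))) := by rw [h, Matrix.neg_mul]

/-- Elements of `kˣ` commute with `y ∈ k` (`k` is commutative). [folklore] -/
theorem mul_eq_mul_of_mem_unitGroup {k : Subalgebra (ZMod p) (Matrix (Fin 2) (Fin 2) (ZMod p))} (hk : IsField k)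
    {y : Matrix (Fin 2) (Fin 2) (ZMod p)} (hy : y ∈ k) {g : GL (Fin 2) (ZMod p)} (hg : g ∈ unitGroup k) :
    (g : Matrix (Fin 2) (Fin 2) (ZMod p)) * y = y * (g : Matrix (Fin 2) (Fin 2) (ZMod p)) :=
  congrArg Subtype.val (hk.mul_comm ⟨_, hg⟩ ⟨y, hy⟩)

end Field

/-! ## §2 The `k`-structure endomorphism of `W[p]` -/

section Curve

variable {F : Type} [Field F] (W : WeierstrassCurve F) {p : ℕ} [Fact p.Prime]

/-- ★ **The `k`-structure endomorphism.** For the small-image datum `(Φ, k, e₀)` — `Φ : Aut(W[p]) ≅ GL₂(𝔽_p)` realised on coordinates `e₀`, `k ⊆ M₂(𝔽_p)` a field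
of degree `2` whose unit group is normalised by `ρ̄(Γ_F)`, `p` odd — there are additive maps `u v : W[p] → W[p]` with `v ∘ u = id`, both commuting with every
`σ ∈ Γ_F` such that `ρ̄(σ) ∈ kˣ`, and `u` ANTI-commuting with every `c` such that `ρ̄(c) ∉ kˣ` (`u` = multiplication by a trace-zero generator `√d` of `k`,
`v = (√d)⁻¹`). These are the hypotheses `u v hu hv hcu hvu` of the cores lemma `injective_corH1_prod_corH1_pushH1` (p765568) with `M = W[p]`.
[cite: Serre1972, §2.2] [cite: SerreGaloisCohomology1997, I §2.6 (b)] -/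
theorem exists_kStructure_endomorphism (hp : p ≠ 2)
    (Φ : Multiplicative (AddAut (geomTorsion W p)) ≃* GL (Fin 2) (ZMod p))
    (k : Subalgebra (ZMod p) (Matrix (Fin 2) (Fin 2) (ZMod p))) (e₀ : geomTorsion W p ≃+ (Fin 2 → ZMod p))
    (he₀ : ∀ (g : Multiplicative (AddAut (geomTorsion W p))) (x : geomTorsion W p),
      e₀ (Multiplicative.toAdd g x) = ((Φ g : GL (Fin 2) (ZMod p)) : Matrix (Fin 2) (Fin 2) (ZMod p)) *ᵥ e₀ x)
    (hk : IsField k) (h2 : Module.finrank (ZMod p) k = 2)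
    (hGN : (galoisRepTorsion W p).range.map Φ.toMonoidHom ≤
      Subgroup.normalizer (Serre1972.unitGroup k : Set (GL (Fin 2) (ZMod p)))) :
    ∃ u v : geomTorsion W p →+ geomTorsion W p,
      (∀ m : geomTorsion W p, v (u m) = m) ∧
      (∀ σ : Field.absoluteGaloisGroup F, Φ (galoisRepTorsion W p σ) ∈ Serre1972.unitGroup k →
        ∀ m : geomTorsion W p, u (σ • m) = σ • u m) ∧
      (∀ σ : Field.absoluteGaloisGroup F, Φ (galoisRepTorsion W p σ) ∈ Serre1972.unitGroup k →
        ∀ m : geomTorsion W p, v (σ • m) = σ • v m) ∧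
      (∀ c : Field.absoluteGaloisGroup F, Φ (galoisRepTorsion W p c) ∉ Serre1972.unitGroup k →
        ∀ m : geomTorsion W p, u (c • m) = -(c • u m)) := by
  obtain ⟨y, hy, hys, htr⟩ := exists_mem_traceZero_forall_ne_smul_one hp h2
  have hy0 : y ≠ 0 := fun h ↦ hys 0 (by rw [h, zero_smul])
  have hdet : IsUnit y.det := (det_ne_zero_of_isField hk hy hy0).isUnit
  -- `u = e₀⁻¹ ∘ (y *ᵥ ·) ∘ e₀`, `v = e₀⁻¹ ∘ (y⁻¹ *ᵥ ·) ∘ e₀`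
  let lin : Matrix (Fin 2) (Fin 2) (ZMod p) → (geomTorsion W p →+ geomTorsion W p) := fun A ↦
    (e₀.symm.toAddMonoidHom.comp (Matrix.mulVecLin A).toAddMonoidHom).comp e₀.toAddMonoidHom
  have hlin : ∀ (A : Matrix (Fin 2) (Fin 2) (ZMod p)) (m : geomTorsion W p), e₀ (lin A m) = A *ᵥ e₀ m := fun A m ↦ by
    simp [lin]
  -- the Galois action on coordinates
  have hact : ∀ (σ : Field.absoluteGaloisGroup F) (m : geomTorsion W p),
      e₀ (σ • m) = ((Φ (galoisRepTorsion W p σ) : GL (Fin 2) (ZMod p)) : Matrix (Fin 2) (Fin 2) (ZMod p)) *ᵥ e₀ m := fun σ m ↦ by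
    rw [← galoisRepTorsion_apply, he₀]
  refine ⟨lin y, lin y⁻¹, fun m ↦ e₀.injective ?_, fun σ hσ m ↦ e₀.injective ?_, fun σ hσ m ↦ e₀.injective ?_,
    fun c hc m ↦ e₀.injective ?_⟩
  · rw [hlin, hlin, Matrix.mulVec_mulVec, Matrix.nonsing_inv_mul _ hdet, Matrix.one_mulVec]
  · rw [hlin, hact, hact, hlin, Matrix.mulVec_mulVec, Matrix.mulVec_mulVec, mul_eq_mul_of_mem_unitGroup hk hy hσ]
  · rw [hlin, hact, hact, hlin, Matrix.mulVec_mulVec, Matrix.mulVec_mulVec,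
      mul_eq_mul_of_mem_unitGroup hk (inv_mem_of_mem k hy) hσ]
  · have hcN : Φ (galoisRepTorsion W p c) ∈ Subgroup.normalizer (Serre1972.unitGroup k : Set (GL (Fin 2) (ZMod p))) :=
      hGN ⟨galoisRepTorsion W p c, ⟨c, rfl⟩, rfl⟩
    rw [hlin, hact, map_neg, hact, hlin, Matrix.mulVec_mulVec, Matrix.mulVec_mulVec, ← Matrix.neg_mulVec,
      conj_eq_neg_of_not_mem_unitGroup hk hy hys htr hcN hc, neg_neg]

end Curve

section Coords

/-- ★ **The `k`-structure endomorphism WITH ITS COORDINATE MATRIX** (append, LEAD g7): the same `u, v` as `exists_kStructure_endomorphism`, exposing the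
trace-zero non-scalar `y ∈ k` with `e₀ (u m) = y *ᵥ e₀ m`, `e₀ (v m) = y⁻¹ *ᵥ e₀ m` — the datum the θ-side transfer (block T, J-loc′) must match: on `M[π]`
the `𝒪`-scalar `ũ` (a lift of the element of `𝔽_{p²} ≅ k` with matrix `y`) is carried by the coordinates `s_j` to `u` («twist compatibility»
`Ψ_j (ũ • s) = u_* Ψ_j s` of `Lines/rtt_w3-GLUE-g7.md` §2). [cite: Serre1972, §2.2] -/
theorem exists_kStructure_endomorphism_coords {F : Type} [Field F] (W : WeierstrassCurve F) {p : ℕ} [Fact p.Prime] (hp : p ≠ 2)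
    (Φ : Multiplicative (AddAut (geomTorsion W p)) ≃* GL (Fin 2) (ZMod p))
    (k : Subalgebra (ZMod p) (Matrix (Fin 2) (Fin 2) (ZMod p))) (e₀ : geomTorsion W p ≃+ (Fin 2 → ZMod p))
    (he₀ : ∀ (g : Multiplicative (AddAut (geomTorsion W p))) (x : geomTorsion W p),
      e₀ (Multiplicative.toAdd g x) = ((Φ g : GL (Fin 2) (ZMod p)) : Matrix (Fin 2) (Fin 2) (ZMod p)) *ᵥ e₀ x)
    (hk : IsField k) (h2 : Module.finrank (ZMod p) k = 2)
    (hGN : (galoisRepTorsion W p).range.map Φ.toMonoidHom ≤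
      Subgroup.normalizer (Serre1972.unitGroup k : Set (GL (Fin 2) (ZMod p)))) :
    ∃ (y : Matrix (Fin 2) (Fin 2) (ZMod p)) (u v : geomTorsion W p →+ geomTorsion W p),
      y ∈ k ∧ (∀ c : ZMod p, y ≠ c • 1) ∧ y.trace = 0 ∧
      (∀ m : geomTorsion W p, e₀ (u m) = y *ᵥ e₀ m) ∧ (∀ m : geomTorsion W p, e₀ (v m) = y⁻¹ *ᵥ e₀ m) ∧
      (∀ m : geomTorsion W p, v (u m) = m) ∧
      (∀ σ : Field.absoluteGaloisGroup F, Φ (galoisRepTorsion W p σ) ∈ Serre1972.unitGroup k →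
        ∀ m : geomTorsion W p, u (σ • m) = σ • u m) ∧
      (∀ σ : Field.absoluteGaloisGroup F, Φ (galoisRepTorsion W p σ) ∈ Serre1972.unitGroup k →
        ∀ m : geomTorsion W p, v (σ • m) = σ • v m) ∧
      (∀ c : Field.absoluteGaloisGroup F, Φ (galoisRepTorsion W p c) ∉ Serre1972.unitGroup k →
        ∀ m : geomTorsion W p, u (c • m) = -(c • u m)) := by
  obtain ⟨y, hy, hys, htr⟩ := exists_mem_traceZero_forall_ne_smul_one hp h2
  have hy0 : y ≠ 0 := fun h ↦ hys 0 (by rw [h, zero_smul])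
  have hdet : IsUnit y.det := (det_ne_zero_of_isField hk hy hy0).isUnit
  let lin : Matrix (Fin 2) (Fin 2) (ZMod p) → (geomTorsion W p →+ geomTorsion W p) := fun A ↦
    (e₀.symm.toAddMonoidHom.comp (Matrix.mulVecLin A).toAddMonoidHom).comp e₀.toAddMonoidHom
  have hlin : ∀ (A : Matrix (Fin 2) (Fin 2) (ZMod p)) (m : geomTorsion W p), e₀ (lin A m) = A *ᵥ e₀ m := fun A m ↦ by
    simp [lin]
  have hact : ∀ (σ : Field.absoluteGaloisGroup F) (m : geomTorsion W p),
      e₀ (σ • m) = ((Φ (galoisRepTorsion W p σ) : GL (Fin 2) (ZMod p)) : Matrix (Fin 2) (Fin 2) (ZMod p)) *ᵥ e₀ m := fun σ m ↦ by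
    rw [← galoisRepTorsion_apply, he₀]
  refine ⟨y, lin y, lin y⁻¹, hy, hys, htr, hlin y, hlin y⁻¹, fun m ↦ e₀.injective ?_, fun σ hσ m ↦ e₀.injective ?_,
    fun σ hσ m ↦ e₀.injective ?_, fun c hc m ↦ e₀.injective ?_⟩
  · rw [hlin, hlin, Matrix.mulVec_mulVec, Matrix.nonsing_inv_mul _ hdet, Matrix.one_mulVec]
  · rw [hlin, hact, hact, hlin, Matrix.mulVec_mulVec, Matrix.mulVec_mulVec, mul_eq_mul_of_mem_unitGroup hk hy hσ]
  · rw [hlin, hact, hact, hlin, Matrix.mulVec_mulVec, Matrix.mulVec_mulVec,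
      mul_eq_mul_of_mem_unitGroup hk (inv_mem_of_mem k hy) hσ]
  · have hcN : Φ (galoisRepTorsion W p c) ∈ Subgroup.normalizer (Serre1972.unitGroup k : Set (GL (Fin 2) (ZMod p))) :=
      hGN ⟨galoisRepTorsion W p c, ⟨c, rfl⟩, rfl⟩
    rw [hlin, hact, map_neg, hact, hlin, Matrix.mulVec_mulVec, Matrix.mulVec_mulVec, ← Matrix.neg_mulVec,
      conj_eq_neg_of_not_mem_unitGroup hk hy hys htr hcN hc, neg_neg]

end Coords

end Summit.BirchSwinnertonDyer.BirchSwinnertonDyer.Theorems.SmallImageCharSignedSelmer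

end
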